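import Summits.Ventures.YMGap.Thresholds.PlaquetteSusceptibility
import HarnessLib

/-!
# Venture YMGap — FINITE STATIC RESPONSE OF EVERY LOCAL OBSERVABLE: in the strong-coupling window the covariances of any
# Lipschitz cylinder observable with ALL plaquettes of `ℤ^d` are absolutely summable

HONEST FRAMING: venture file of the cell `pub-ymgap` (QuantumFields programme), seat ds-1; the general-observable form of the
C-SUS row type (`PlaquetteSusceptibility` is the case `F = W_p`).  Strong-coupling LATTICE statement for `SU(N)` lattice Yang–Mills
on `ℤ^d` with the Wilson action, a COROLLARY of the cell's currency `MassGapAt d N β`.  The sum `Σ_q |Cov_μ(F, W_q)|`,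
`W_q = (1/N) Re tr U_q`, is the absolute value budget of the formal linear response `(d/dβ)⟨F⟩_β = N Σ_q Cov(F, N W_q)`; this
file proves ONLY its finiteness (no differentiability statement); nothing about the continuum or the Clay problem.

* `abs_cov_cylinder_plaquette_le_of_decay` — from the clustering clause of `MassGapAt` at support size `max n 4`: for a Lipschitz
  cylinder `F` (support `Λ ∋` some link based within sup-distance `D` of `x₀`, `#Λ ≤ n`, constant `K`, `|F| ≤ 1`) and every
  plaquette `q = (y, ·)`: `|Cov_μ(F, W_q)| ≤ C(c₁, c, K, N) · e^{cD} · e^{−(c/√d) |x₀ − y|₂}`.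
* `summable_abs_cov_cylinder_plaquette_of_massGapAt` — `MassGapAt d N β` ⇒ for every DLR state `μ` and every such `F`:
  `q ↦ |Cov_μ(F, W_q)|` is summable over all plaquettes and `Σ_q |Cov_μ(F, W_q)| ≤ C e^{cD} D_d ((1+r)/(1−r))^d`, `r = e^{−c/(d√d)}`.
* Rows: `su2_summable_abs_cov_cylinder_plaquette` (`SU(2)`, `d = 4`, `|β| ≤ 9/100`), `summable_abs_cov_cylinder_plaquette_SU`
  (`N ≥ 2`, `d = 4`, `|β| ≤ 9/308`).

References (mechanism): H. Shen, R. Zhu, X. Zhu, CMP 400 (2023), Cor. 1.6; B. Simon, *The Statistical Mechanics of Lattice Gases* I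
(1993), §II.12.
-/

noncomputable section

open MeasureTheory Function Finset ProbabilityTheory Real
open scoped NNReal
open Literature.Probability.LatticeModels
open Literature.MathematicalPhysics.QuantumLattice (fundamentalRep fundamentalRep_mem_unitaryGroup ymSpecification ymGibbsMeasures
  LGConfig ZdEdge ZdPlaquette plaquetteEdges)
open Literature.MathematicalPhysics.QuantumFieldTheory hiding ZdEdge
open Summit.Ventures.YMGap.RobustBall (l1 norm_le_l1 numOrient sum_plaquette_base_le sum_pow_l1_sub_le)
open Summit.Ventures.YMGap.PlaquetteSusceptibility (exp_neg_latticeNorm_le_pow)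

namespace Summit.Ventures.YMGap.LinearResponseBound

variable {d N : ℕ}

/-- The `L²(μ)` norm of an observable bounded by `1` is at most `1`. [folklore] -/
theorem sqrt_integral_sq_le_one {Ω : Type*} [MeasurableSpace Ω] {μ : Measure Ω} [IsProbabilityMeasure μ] {F : Ω → ℝ}
    (hF : ∀ U, |F U| ≤ 1) : Real.sqrt (∫ U, F U ^ 2 ∂μ) ≤ 1 := by
  have hb : ∀ U, |F U ^ 2| ≤ 1 := fun U => by
    rw [abs_pow]; exact pow_le_one₀ (abs_nonneg _) (hF U)
  have hint := norm_integral_le_of_norm_le_const (μ := μ) (f := fun U => F U ^ 2) (C := 1)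
    (ae_of_all _ fun U => by simpa only [Real.norm_eq_abs] using hb U)
  have h1 : ∫ U, F U ^ 2 ∂μ ≤ 1 := (le_abs_self _).trans (by simpa [Real.norm_eq_abs] using hint)
  calc Real.sqrt _ ≤ Real.sqrt 1 := Real.sqrt_le_sqrt h1
    _ = 1 := Real.sqrt_one

/-- **Covariance of a Lipschitz cylinder observable with a plaquette, exponential decay in the base point.**  From the
clustering clause of `MassGapAt` at support size `max n 4` (constants `c > 0`, `c₁`): for a Lipschitz cylinder `F` on `Λ`
(`#Λ ≤ n`, constant `K`, `|F| ≤ 1`, every link of `Λ` based within sup-distance `D` of `x₀`, `Λ` nonempty) and every plaquette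
`(y, k < l)`: `|Cov_μ(F, W_{y,kl})| ≤ max(max c₁ 0 · e^{2c} (4N³ K + 1), 4 e^{2c}) · e^{cD} · e^{−(c/√d)|x₀ − y|₂}`.
[cite: arXiv220412737, Cor. 1.6 (Mass gap)] -/
theorem abs_cov_cylinder_plaquette_le_of_decay (hd : 0 < d)
    {μ : Measure (LGConfig d (Matrix.specialUnitaryGroup (Fin N) ℂ))} [IsProbabilityMeasure μ]
    {c c₁ : ℝ} (hc : 0 < c) {n : ℕ}
    (hc₁ : ∀ (F₁ F₂ : LGConfig d (Matrix.specialUnitaryGroup (Fin N) ℂ) → ℝ)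
      (Λ₁ Λ₂ : Finset (ZdEdge d)) (K₁ K₂ : ℝ≥0),
      Λ₁.card ≤ max n 4 → Λ₂.card ≤ max n 4 → Disjoint Λ₁ Λ₂ →
      IsLipschitzCylinder (fundamentalRep (Fin N)) F₁ Λ₁ K₁ →
      IsLipschitzCylinder (fundamentalRep (Fin N)) F₂ Λ₂ K₂ →
        |cov[F₁, F₂; μ]| ≤ c₁ * Real.exp (-c * setDistEdges Λ₁ Λ₂) *
          ((K₁ : ℝ) * K₂ + Real.sqrt (∫ U, F₁ U ^ 2 ∂μ) * Real.sqrt (∫ U, F₂ U ^ 2 ∂μ)))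
    {F : LGConfig d (Matrix.specialUnitaryGroup (Fin N) ℂ) → ℝ} {Λ : Finset (ZdEdge d)} {K : ℝ≥0}
    (hF : IsLipschitzCylinder (fundamentalRep (Fin N)) F Λ K) (hΛn : Λ.card ≤ n) (hΛne : Λ.Nonempty)
    (hF1 : ∀ U, |F U| ≤ 1) {x₀ : Literature.Probability.LatticeModels.Site d} {D : ℝ}
    (hD : ∀ e ∈ Λ, ‖e.1 - x₀‖ ≤ D)
    (y : Literature.Probability.LatticeModels.Site d) {k l : Fin d} (hkl : k < l) :
    |cov[F, zdPlaquetteObs (fundamentalRep (Fin N)) y k l; μ]| ≤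
      max (max c₁ 0 * Real.exp (2 * c) * ((K : ℝ) * ((4 * (N : ℝ≥0) ^ 3 : ℝ≥0) : ℝ) + 1)) (4 * Real.exp (2 * c)) *
        Real.exp (c * D) * Real.exp (-(c / Real.sqrt d) * latticeNorm (x₀ - y)) := by
  have hρu : ∀ g, fundamentalRep (Fin N) g ∈ Matrix.unitaryGroup (Fin N) ℂ := fundamentalRep_mem_unitaryGroup
  have hd0 : (0 : ℝ) < Real.sqrt d := Real.sqrt_pos.2 (by exact_mod_cast hd)
  have hD0 : 0 ≤ D := by obtain ⟨e, he⟩ := hΛne; exact (norm_nonneg _).trans (hD e he)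
  -- `m L ≤ c · nxy` with `nxy = ‖x₀ − y‖ − D`, `L = |x₀ − y|₂/√d − D`… we run the tree's bookkeeping with
  -- `L := latticeNorm (x₀ − y) − √d D` and `m := c/√d`.
  set L : ℝ := latticeNorm (x₀ - y) - Real.sqrt d * D with hL
  have hLm : c / Real.sqrt d * L ≤ c * (‖x₀ - y‖ - D) := by
    have h1 : c / Real.sqrt d * latticeNorm (x₀ - y) ≤ c * ‖x₀ - y‖ := by
      calc c / Real.sqrt d * latticeNorm (x₀ - y) ≤ c / Real.sqrt d * (Real.sqrt d * ‖x₀ - y‖) :=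
            mul_le_mul_of_nonneg_left (latticeNorm_le_sqrt_mul_norm _) (div_pos hc hd0).le
        _ = c * ‖x₀ - y‖ := by field_simp
    have h2 : c / Real.sqrt d * (Real.sqrt d * D) = c * D := by field_simp
    rw [hL, mul_sub, h2]
    linarith
  have hexpL : Real.exp (-(c / Real.sqrt d) * L) = Real.exp (c * D) * Real.exp (-(c / Real.sqrt d) * latticeNorm (x₀ - y)) := by
    rw [← Real.exp_add, hL]
    congr 1
    field_simp
    ring
  have hne_q : (plaquetteEdges ((y, ⟨(k, l), hkl⟩) : ZdPlaquette d)).Nonempty := ⟨(y, k), by simp [plaquetteEdges]⟩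
  have key : |cov[F, zdPlaquetteObs (fundamentalRep (Fin N)) y k l; μ]| ≤
      max (max c₁ 0 * Real.exp (2 * c) * ((K : ℝ) * ((4 * (N : ℝ≥0) ^ 3 : ℝ≥0) : ℝ) + 1)) (4 * Real.exp (2 * c)) *
        Real.exp (-(c / Real.sqrt d) * L) := by
    by_cases hdisj : Disjoint Λ (plaquetteEdges ((y, ⟨(k, l), hkl⟩) : ZdPlaquette d))
    · have hcov := hc₁ _ _ _ _ _ _ (hΛn.trans (le_max_left _ _)) ((card_plaquetteEdges_le _).trans (le_max_right _ _))
        hdisj hF (isLipschitzCylinder_zdPlaquetteObs y hkl)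
      have hDist : (‖x₀ - y‖ - D) - 2 ≤ setDistEdges Λ (plaquetteEdges ((y, ⟨(k, l), hkl⟩) : ZdPlaquette d)) := by
        refine le_setDistEdges_of_forall hΛne hne_q fun e he e' he' => ?_
        have h1 := hD e he
        have h2 := norm_fst_sub_le_of_mem_plaquetteEdges he'
        have heq : x₀ - y = (e.1 - e'.1) - (e.1 - x₀) + (e'.1 - y) := by abel
        calc ‖x₀ - y‖ - D - 2 = ‖(e.1 - e'.1) - (e.1 - x₀) + (e'.1 - y)‖ - D - 2 := by rw [← heq]
          _ ≤ ‖e.1 - e'.1‖ + ‖e.1 - x₀‖ + ‖e'.1 - y‖ - D - 2 := by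
              gcongr
              exact (norm_add_le _ _).trans (add_le_add (norm_sub_le _ _) le_rfl)
          _ ≤ ‖e.1 - e'.1‖ := by simp only at h2; linarith
      exact decay_bound_aux hc hcov (mul_nonneg (NNReal.coe_nonneg _) (NNReal.coe_nonneg _))
        (Real.sqrt_nonneg _) (sqrt_integral_sq_le_one hF1) (Real.sqrt_nonneg _)
        (sqrt_integral_sq_le_one (abs_zdPlaquetteObs_le hρu y k l)) hDist hLm
    · have hnear : ‖x₀ - y‖ - D ≤ 2 := by
        obtain ⟨e, heΛ, heq⟩ := Finset.not_disjoint_iff.1 hdisj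
        have h1 := hD e heΛ
        have h2 := norm_fst_sub_le_of_mem_plaquetteEdges heq
        simp only at h2
        have : x₀ - y = (e.1 - y) - (e.1 - x₀) := by abel
        rw [this]
        linarith [norm_sub_le (e.1 - y) (e.1 - x₀)]
      exact near_bound_aux hc (abs_covariance_le_four hF1 (abs_zdPlaquetteObs_le hρu y k l)) hnear hLm
  calc _ ≤ _ := key
    _ = _ := by rw [hexpL]; ring

/-- Base-point form of rb-p1's lattice sum: for `0 ≤ r < 1`, `c ≥ 0` and every site `x₀`, `q ↦ c · r^{‖x₀ − x_q‖₁}` is summable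
over all plaquettes of `ℤ^d` with sum `≤ c · D_d ((1+r)/(1−r))^d`. [folklore] -/
theorem summable_and_tsum_base_le {r c : ℝ} (hc : 0 ≤ c) (h0 : 0 ≤ r) (h1 : r < 1)
    (x₀ : Literature.Probability.LatticeModels.Site d) :
    (Summable fun q : ZdPlaquette d => c * r ^ l1 (x₀ - q.1)) ∧
      ∑' q : ZdPlaquette d, c * r ^ l1 (x₀ - q.1) ≤ c * (numOrient d * ((1 + r) / (1 - r)) ^ d) := by
  have hf0 : ∀ q : ZdPlaquette d, 0 ≤ c * r ^ l1 (x₀ - q.1) := fun q => by positivity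
  have hS : ∀ S : Finset (ZdPlaquette d), ∑ q ∈ S, c * r ^ l1 (x₀ - q.1) ≤ c * (numOrient d * ((1 + r) / (1 - r)) ^ d) := by
    intro S
    rw [← Finset.mul_sum]
    exact mul_le_mul_of_nonneg_left (sum_plaquette_base_le (f := fun x => r ^ l1 (x₀ - x)) (fun x => pow_nonneg h0 _)
      (sum_pow_l1_sub_le h0 h1 x₀) S) hc
  exact ⟨summable_of_sum_le hf0 hS, Real.tsum_le_of_sum_le hf0 hS⟩

/-- **FINITE STATIC RESPONSE OF EVERY LOCAL OBSERVABLE from the mass-gap currency.**  `MassGapAt d N β` (`d ≥ 1`) ⇒ for every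
DLR state `μ`, every support-size bound `n` and every radius `D` there is one `χ` such that for every Lipschitz cylinder `F`
(support `Λ` nonempty, `#Λ ≤ n`, every link of `Λ` based within sup-distance `D` of some `x₀`, constant `K`, `|F| ≤ 1`):
`q ↦ |Cov_μ(F, W_q)|` is summable over ALL plaquettes of `ℤ^d` and `Σ_q |Cov_μ(F, W_q)| ≤ χ · (K + 1)`.
[cite: arXiv220412737, Cor. 1.6 (Mass gap)] -/
theorem summable_abs_cov_cylinder_plaquette_of_massGapAt (hd : 1 ≤ d) {β : ℝ} (h : MassGapAt d N β)
    {μ : Measure (LGConfig d (Matrix.specialUnitaryGroup (Fin N) ℂ))}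
    (hμ : μ ∈ ymGibbsMeasures (d := d) (fundamentalRep (Fin N)) (N * β)) (n : ℕ) (D : ℝ) :
    ∃ χ : ℝ, ∀ {F : LGConfig d (Matrix.specialUnitaryGroup (Fin N) ℂ) → ℝ} {Λ : Finset (ZdEdge d)} {K : ℝ≥0}
      {x₀ : Literature.Probability.LatticeModels.Site d},
      IsLipschitzCylinder (fundamentalRep (Fin N)) F Λ K → Λ.card ≤ n → Λ.Nonempty → (∀ U, |F U| ≤ 1) →
      (∀ e ∈ Λ, ‖e.1 - x₀‖ ≤ D) →
        Summable (fun q : ZdPlaquette d => |cov[F, zdPlaquetteObs (fundamentalRep (Fin N)) q.1 q.2.1.1 q.2.1.2; μ]|) ∧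
          ∑' q : ZdPlaquette d, |cov[F, zdPlaquetteObs (fundamentalRep (Fin N)) q.1 q.2.1.1 q.2.1.2; μ]| ≤ χ * ((K : ℝ) + 1) := by
  classical
  have hμ' : IsGibbsMeasure (ymSpecification (d := d) (fundamentalRep (Fin N)) (N * β)) μ := hμ
  haveI := hμ'.isProbabilityMeasure
  obtain ⟨c, hc, hn⟩ := h.2 μ hμ
  obtain ⟨c₁, hc₁⟩ := hn (max n 4)
  have hdpos : (0 : ℝ) < d := by exact_mod_cast (show 0 < d by omega)
  set r : ℝ := exp (-(c / Real.sqrt d / d)) with hr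
  have hr0 : 0 ≤ r := (exp_pos _).le
  have hr1 : r < 1 := by rw [hr]; exact Real.exp_lt_one_iff.2 (neg_neg_of_pos (by positivity))
  -- one constant for all `F` with `|F| ≤ 1`: `A (K + 1) e^{cD}` dominates the pointwise constant
  set A : ℝ := max (max c₁ 0 * Real.exp (2 * c) * (4 * (N : ℝ) ^ 3 + 1)) (4 * Real.exp (2 * c)) with hA
  have hA0 : 0 ≤ A := le_max_of_le_right (by positivity)
  refine ⟨A * Real.exp (c * D) * (numOrient d * ((1 + r) / (1 - r)) ^ d), ?_⟩
  intro F Λ K x₀ hF hΛn hΛne hF1 hD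
  have hK0 : (0 : ℝ) ≤ K := K.2
  set CF : ℝ := max (max c₁ 0 * Real.exp (2 * c) * (((K * (4 * (N : ℝ≥0) ^ 3) : ℝ≥0) : ℝ) + 1)) (4 * Real.exp (2 * c)) *
    Real.exp (c * D) with hCF
  have hCF0 : 0 ≤ CF := mul_nonneg (le_max_of_le_right (by positivity)) (exp_pos _).le
  have hCFA : CF ≤ A * ((K : ℝ) + 1) * Real.exp (c * D) := by
    rw [hCF]
    refine mul_le_mul_of_nonneg_right ?_ (exp_pos _).le
    refine max_le ?_ ?_
    · push_cast
      have h1 : max c₁ 0 * Real.exp (2 * c) * ((K : ℝ) * (4 * (N : ℝ) ^ 3) + 1) ≤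
          max c₁ 0 * Real.exp (2 * c) * (4 * (N : ℝ) ^ 3 + 1) * ((K : ℝ) + 1) := by
        have hm : 0 ≤ max c₁ 0 * Real.exp (2 * c) := by positivity
        have hN3 : (0 : ℝ) ≤ 4 * (N : ℝ) ^ 3 := by positivity
        have : (K : ℝ) * (4 * (N : ℝ) ^ 3) + 1 ≤ (4 * (N : ℝ) ^ 3 + 1) * ((K : ℝ) + 1) := by nlinarith
        calc _ ≤ max c₁ 0 * Real.exp (2 * c) * ((4 * (N : ℝ) ^ 3 + 1) * ((K : ℝ) + 1)) := mul_le_mul_of_nonneg_left this hm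
          _ = _ := by ring
      exact h1.trans (mul_le_mul_of_nonneg_right (le_max_left _ _) (by positivity))
    · calc 4 * Real.exp (2 * c) ≤ A := le_max_right _ _
        _ ≤ A * ((K : ℝ) + 1) := le_mul_of_one_le_right hA0 (by linarith [hK0])
  have hpt : ∀ q : ZdPlaquette d,
      |cov[F, zdPlaquetteObs (fundamentalRep (Fin N)) q.1 q.2.1.1 q.2.1.2; μ]| ≤ CF * r ^ l1 (x₀ - q.1) := by
    intro q
    have hdec := abs_cov_cylinder_plaquette_le_of_decay (N := N) (by omega) hc hc₁ hF hΛn hΛne hF1 hD q.1 q.2.2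
    refine hdec.trans (mul_le_mul_of_nonneg_left ?_ hCF0)
    have := exp_neg_latticeNorm_le_pow hd (div_pos hc (Real.sqrt_pos.2 hdpos)).le (x₀ - q.1)
    simpa only [hr, neg_mul] using this
  have hrow := summable_and_tsum_base_le (d := d) hCF0 hr0 hr1 x₀
  have hsum : Summable fun q : ZdPlaquette d =>
      |cov[F, zdPlaquetteObs (fundamentalRep (Fin N)) q.1 q.2.1.1 q.2.1.2; μ]| :=
    Summable.of_nonneg_of_le (fun q => abs_nonneg _) hpt hrow.1
  refine ⟨hsum, ((hsum.tsum_le_tsum hpt hrow.1).trans hrow.2).trans ?_⟩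
  have hG : 0 ≤ (numOrient d : ℝ) * ((1 + r) / (1 - r)) ^ d := by
    have : 0 < 1 - r := by linarith
    positivity
  calc CF * (numOrient d * ((1 + r) / (1 - r)) ^ d)
      ≤ A * ((K : ℝ) + 1) * Real.exp (c * D) * (numOrient d * ((1 + r) / (1 - r)) ^ d) := mul_le_mul_of_nonneg_right hCFA hG
    _ = A * Real.exp (c * D) * (numOrient d * ((1 + r) / (1 - r)) ^ d) * ((K : ℝ) + 1) := by ring

/-- **`SU(2)`, `d = 4`, hypothesis-free**: at every 't Hooft `|β| ≤ 9/100` every DLR state has finite static response of every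
Lipschitz cylinder observable against the plaquette field. [cite: arXiv220412737, Cor. 1.6 (Mass gap)] -/
theorem su2_summable_abs_cov_cylinder_plaquette {β : ℝ} (hβ : |β| ≤ 9 / 100)
    {μ : Measure (LGConfig 4 (Matrix.specialUnitaryGroup (Fin 2) ℂ))}
    (hμ : μ ∈ ymGibbsMeasures (d := 4) (fundamentalRep (Fin 2)) (2 * β)) (n : ℕ) (D : ℝ) :
    ∃ χ : ℝ, ∀ {F : LGConfig 4 (Matrix.specialUnitaryGroup (Fin 2) ℂ) → ℝ} {Λ : Finset (ZdEdge 4)} {K : ℝ≥0}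
      {x₀ : Literature.Probability.LatticeModels.Site 4},
      IsLipschitzCylinder (fundamentalRep (Fin 2)) F Λ K → Λ.card ≤ n → Λ.Nonempty → (∀ U, |F U| ≤ 1) →
      (∀ e ∈ Λ, ‖e.1 - x₀‖ ≤ D) →
        Summable (fun q : ZdPlaquette 4 => |cov[F, zdPlaquetteObs (fundamentalRep (Fin 2)) q.1 q.2.1.1 q.2.1.2; μ]|) ∧
          ∑' q : ZdPlaquette 4, |cov[F, zdPlaquetteObs (fundamentalRep (Fin 2)) q.1 q.2.1.1 q.2.1.2; μ]| ≤ χ * ((K : ℝ) + 1) :=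
  summable_abs_cov_cylinder_plaquette_of_massGapAt (by norm_num) (ImprovedThresholdStar.su2_massGapAt_of_abs_le hβ) hμ n D

/-- **Every `SU(N)`, `N ≥ 2`, `d = 4`, hypothesis-free**: at every 't Hooft `|β| ≤ 9/308`. [cite: arXiv220412737, Cor. 1.6 (Mass gap)] -/
theorem summable_abs_cov_cylinder_plaquette_SU (hN : 2 ≤ N) {β : ℝ} (hβ : |β| ≤ 9 / 308)
    {μ : Measure (LGConfig 4 (Matrix.specialUnitaryGroup (Fin N) ℂ))}
    (hμ : μ ∈ ymGibbsMeasures (d := 4) (fundamentalRep (Fin N)) (N * β)) (n : ℕ) (D : ℝ) :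
    ∃ χ : ℝ, ∀ {F : LGConfig 4 (Matrix.specialUnitaryGroup (Fin N) ℂ) → ℝ} {Λ : Finset (ZdEdge 4)} {K : ℝ≥0}
      {x₀ : Literature.Probability.LatticeModels.Site 4},
      IsLipschitzCylinder (fundamentalRep (Fin N)) F Λ K → Λ.card ≤ n → Λ.Nonempty → (∀ U, |F U| ≤ 1) →
      (∀ e ∈ Λ, ‖e.1 - x₀‖ ≤ D) →
        Summable (fun q : ZdPlaquette 4 => |cov[F, zdPlaquetteObs (fundamentalRep (Fin N)) q.1 q.2.1.1 q.2.1.2; μ]|) ∧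
          ∑' q : ZdPlaquette 4, |cov[F, zdPlaquetteObs (fundamentalRep (Fin N)) q.1 q.2.1.1 q.2.1.2; μ]| ≤ χ * ((K : ℝ) + 1) :=
  summable_abs_cov_cylinder_plaquette_of_massGapAt (by norm_num) (StarSUNLimit.massGapAt_SU_star hN hβ) hμ n D

end Summit.Ventures.YMGap.LinearResponseBound

end
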